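import Mathlib
import HarnessLib
import Literature.Analysis.FluidPDE.SelfSimilar
import Literature.Analysis.FluidPDE.VectorCalculus
import Literature.Analysis.FluidPDE.TypeIAncientMild
import Literature.Analysis.FluidPDE.ElgindiBlowup
import Literature.Analysis.UnboundedOperators.HeatKernel
import Summits.NavierStokesRegularity.NavierStokesRegularity.Theorems.PoloidalWindowDoorPoloidalWindowRigidityWindow
import Summits.NavierStokesRegularity.NavierStokesRegularity.Theorems.SqueezeCycleExtremalBiaxialitySubcriticalGaugeStrainBound

/-!
# `ImplosionDoor.PassiveRadialVorticity` (stmt-NavierStokesRegularity-25305) — line `birth`,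
# provable-first stub `stub_vorticityBound` PROVED: the scale-invariant Type-I vorticity bound
# `‖curl v(s)‖_∞ ≤ C′/(−s)` for the Oseen-mild Type-I ancient class

Registered stub of the skeleton of record `Cruxes/PassiveRadialVorticity/Lines/birth` (planner ns-idea-6,
`PassiveRadialVorticity_birth_g3.lean`, sha 7fb62332…), VERBATIM, so the line's `sorry` at `stub_vorticityBound`
closes by `exact …Theorems.ImplosionDoorPassiveRadialVorticityStubVorticityBound.stub_vorticityBound`.

PROOF (a sign-free class lemma, tree chain).  The four class hypotheses (Type-I time rate, continuity on the
open slab, unit-viscosity Oseen-mild identity between negative times, divergence-free slices) are the tree's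
`IsTypeIAncientMild C v` (`…PoloidalWindowDoorPoloidalWindowRigidityWindow.isTypeIAncientMild_of_class`: joint
real-analyticity of the class supplies the smoothness conjunct).  KNSS 2009 Prop. 4.1 smoothing in the gauge of
the class, already in the tree as the CLASS-UNIFORM scale-invariant gradient bound
`…exists_gauge_norm_fderiv_le_of_typeI : ∃ K₀, IsTypeIAncientMild C v → ∀ t < 0, ∀ x, (−t)‖Dv(t)(x)‖ ≤ K₀`
(zoom to `t = −1` + `exists_norm_iteratedFDeriv_le_of_typeI`), and the pointwise `‖curl v‖ ≤ 4‖Dv‖`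
(`norm_curl_le_four_mul`) give `‖curl v(s)(y)‖ ≤ 4K₀/(−s)`.

HONEST FRAMING: a regularity estimate for HYPOTHETICAL blow-up profiles (KNSS-type ancient mild solutions);
nothing here bears on Navier–Stokes regularity; no summit statement is proved.
-/

noncomputable section

-- the summit and its single sub-problem share the name (CONVENTIONS §1), as in every Theorems file
set_option linter.dupNamespace false

namespace Summit.NavierStokesRegularity.NavierStokesRegularity.Theorems.ImplosionDoorPassiveRadialVorticityStubVorticityBound

open Set Function
open Literature.Analysis Literature.Analysis.FluidPDE
open Summit.NavierStokesRegularity.NavierStokesRegularity.Theorems.PoloidalWindowDoorPoloidalWindowRigidityWindow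

/-- **Stub `stub_vorticityBound` of line `birth` (crux `PassiveRadialVorticity`, stmt-25305), VERBATIM**: for a
profile of the route's Type-I ancient Oseen-mild class there is `C′` with `‖curl v(s)(y)‖ ≤ C′/(−s)` for all
`s < 0`, `y` (KNSS smoothing in the class gauge: `(−s)‖Dv(s)‖ ≤ K₀(C)`, and `‖curl‖ ≤ 4‖D·‖`).
[cite: KochNadirashviliSereginSverak2009, Prop. 4.1 (4.10) (arXiv:0709.3599 p. 8)] -/
theorem stub_vorticityBound : ∀ (C : ℝ) (v : ℝ → EuclideanSpace ℝ (Fin 3) → EuclideanSpace ℝ (Fin 3)), Literature.Analysis.FluidPDE.HasTypeITimeDecay C v → ContinuousOn (Function.uncurry v) (Set.Iio (0 : ℝ) ×ˢ Set.univ) → (∀ s t : ℝ, s < t → t < 0 → ∀ x, v t x = Literature.Analysis.UnboundedOperators.heatExtension (v s) (t - s) x - Literature.Analysis.FluidPDE.oseenDuhamel 1 s v v t x) → (∀ t < 0, Literature.Analysis.FluidPDE.VectorCalculus.IsDivFree (v t)) → ∃ C' : ℝ, ∀ s < 0, ∀ y, ‖Literature.Analysis.FluidPDE.curl (v s) y‖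 ≤ C' / (-s) := by
  intro C v hrate hcont hmild hdiv
  -- the class is the tree's `IsTypeIAncientMild`
  have hA : IsTypeIAncientMild C v := isTypeIAncientMild_of_class hrate hcont hmild hdiv
  -- class-uniform scale-invariant gradient bound
  obtain ⟨K₀, hK₀⟩ := exists_gauge_norm_fderiv_le_of_typeI C
  refine ⟨4 * K₀, fun s hs y => ?_⟩
  have hs' : 0 < -s := neg_pos.2 hs
  have h1 : (-s) * ‖fderiv ℝ (v s) y‖ ≤ K₀ := hK₀ hA s hs y
  have h2 : ‖fderiv ℝ (v s) y‖ ≤ K₀ / (-s) := by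
    rw [le_div_iff₀ hs', mul_comm]
    exact h1
  calc ‖curl (v s) y‖ ≤ 4 * ‖fderiv ℝ (v s) y‖ := norm_curl_le_four_mul _ _
    _ ≤ 4 * (K₀ / (-s)) := by gcongr
    _ = 4 * K₀ / (-s) := by ring

end Summit.NavierStokesRegularity.NavierStokesRegularity.Theorems.ImplosionDoorPassiveRadialVorticityStubVorticityBound

end
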